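/-
VALUE = THEOREM (stabiliser of an anisotropic vector in a reflection class group), NOT summit
progress (cell b2b-lgcu-borel, gen 24); the crux item stmt-MatrixMultiplication-14079 is untouched.
-/
import Mathlib
import Literature.NumberTheory.EllipticCurves.BinaryQuarticDiscriminantFpCountProofs
import Summits.MatrixMultiplication.MatrixMultiplication.Theorems.SubgroupIdentityDesigns.Negative.ReflectionClassIsoSign
import Summits.MatrixMultiplication.MatrixMultiplication.Theorems.SubgroupIdentityDesigns.Negative.ReflectionClassStabAniso

/-!
# The stabiliser of an anisotropic `x` in the reflection class group `K = classGroup p σ`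

VALUE = THEOREM (generic in the prime `p`), NOT summit progress; the crux item
stmt-MatrixMultiplication-14079 is untouched and remains open.

Layer F4b of the all-`p` proof of the unified reflection-class certificate (ORACLE-g24 §G24-1 (L1),
§G24-2/3).  `K = classGroup p σ ≤ GL₃(𝔽_p)` is generated by the reflections `R_b` with
`IsSquare (Q b) = σ`.  For `x` with `q = Q(x) ≠ 0` and a frame `w₁ = x × ω` with `Q(w₁) ≠ 0`
(`ReflectionClassPlane`, `ReflectionClassIsoLines.exists_frame`), `W = x^⊥`:

* `class_of_refl_mem` — `R_b ∈ K` forces `b` to have the class `σ` (via the sign character `ι`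
  of `ReflectionClassIsoSign`);
* `exists_class` — `W` contains anisotropic vectors of BOTH classes;
* `refl_mul_refl_mem` — `R_z R_{z₀} ∈ K` for anisotropic `z, z₀ ∈ W` of the SAME class (either
  class!): the non-generator case is `R_z R_{z₀} = R_{b'} R_{a'}` with `a' ∈ W` of class `σ` and
  `R_{b'} = R_z R_{z₀} R_{a'}` by `ReflectionClassStabAniso.stab_improper`, `b'` of class `σ` by `ι`;
* `stab_improper_iff` / `stab_proper_iff` — THE STABILISER: `s ∈ K`, `s x = x` iff
  `s = R_z` (`z ∈ W` of class `σ`, `det s = −1`) or `s = R_z R_{z₀}` (`z ∈ W` of the class of the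
  fixed anisotropic `z₀ ∈ W`, `det s = 1`);
* `refl_eq_refl_iff` — `R_z = R_{z'}` iff `z' ∈ 𝔽_p^× z` (fibres of the parametrisation).
HONEST SCOPE.  Group-theoretic input of the orbit-sum assembly (F7); by itself it excludes nothing.
-/

set_option linter.dupNamespace false

open scoped BigOperators Matrix

namespace Summit.MatrixMultiplication.MatrixMultiplication.Theorems.SubgroupIdentityDesigns.Negative
namespace ReflectionClassStabClass

open Summit.MatrixMultiplication.MatrixMultiplication.Theorems.LieRankDesigns.Negative (GLm Mat)
open ReflectionClassCertificate (V classGroup)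
open NonsquareReflections (reflMat refl coe_refl reflMat_mul_self reflMat_mulVec det_reflMat)
open ReflectionClassPlane (w₁ w₂ w₁_dot_x w₂_dot_x w₁_dot_w₂ w₂_dot_self refl_smul)
open ReflectionClassIsoSign (O3 mem_O3 refl_mem_O3 iota reflO coe_reflO iota_reflO eps eps_sq
  iota_of_mem_classGroup)
open ReflectionClassStabAniso (stab_proper stab_improper eq_smul_of_reflMat_eq frame_dot_frame)
open DihedralUnipotent (neg_one_ne_one)
open ReflectionClassPlane (frame)
open Literature.NumberTheory.EllipticCurves.BinaryQuartic (two_ne_zero_zmod)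

variable {p : ℕ} [hp : Fact p.Prime]

/-! ## Classes and the quadratic character -/

/-- `χ(a) = ε_{class a}` for `a ≠ 0`. -/
theorem qchar_eq_eps {a : ZMod p} (ha : a ≠ 0) :
    quadraticChar (ZMod p) a = eps (decide (IsSquare a)) := by
  by_cases h : IsSquare a
  · simp [eps, h, (quadraticChar_one_iff_isSquare ha).mpr h]
  · simp [eps, h, quadraticChar_neg_one_iff_not_isSquare.mpr h]

/-- `ε` is injective. -/
theorem eps_inj {σ τ : Bool} : eps σ = eps τ ↔ σ = τ := by
  cases σ <;> cases τ <;> simp [eps]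

/-- `ε_σ ε_σ = 1`. -/
theorem eps_mul_self (σ : Bool) : eps σ * eps σ = 1 := by rw [← sq, eps_sq]

/-- Same class iff equal characters (`a, b ≠ 0`). -/
theorem qchar_eq_iff {a b : ZMod p} (ha : a ≠ 0) (hb : b ≠ 0) :
    quadraticChar (ZMod p) a = quadraticChar (ZMod p) b ↔ (IsSquare a ↔ IsSquare b) := by
  rw [qchar_eq_eps ha, qchar_eq_eps hb, eps_inj]
  constructor
  · intro h; exact ⟨fun h1 => of_decide_eq_true (h ▸ decide_eq_true h1),
      fun h2 => of_decide_eq_true (h.symm ▸ decide_eq_true h2)⟩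
  · intro h; by_cases h1 : IsSquare a
    · rw [decide_eq_true h1, decide_eq_true (h.mp h1)]
    · rw [decide_eq_false h1, decide_eq_false (fun h2 => h1 (h.mpr h2))]

/-! ## Reflections in `K` -/

section K

variable {σ : Bool}

/-- Generators: a reflection of the class `σ` lies in `K`. -/
theorem refl_mem_classGroup {b : V p} (hb : b ⬝ᵥ b ≠ 0) (hσ : decide (IsSquare (b ⬝ᵥ b)) = σ) :
    refl b ∈ classGroup p σ :=
  Subgroup.subset_closure ⟨b, hb, hσ, rfl⟩

/-- **Conversely, `R_b ∈ K` forces the class of `b` to be `σ`** (`ι(R_b) = χ(Q b)` must be `ε_σ`). -/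
theorem class_of_refl_mem (hp2 : p ≠ 2) {b : V p} (hb : b ⬝ᵥ b ≠ 0)
    (h : refl b ∈ classGroup p σ) : decide (IsSquare (b ⬝ᵥ b)) = σ := by
  obtain ⟨hO, ⟨hd, -⟩ | ⟨-, hι⟩⟩ := iota_of_mem_classGroup hp2 σ h
  · exact absurd (by rwa [coe_refl, det_reflMat b hb] at hd) (neg_one_ne_one hp2)
  · have h1 : ((iota ⟨refl b, hO⟩ : ℤˣ) : ℤ) = quadraticChar (ZMod p) (b ⬝ᵥ b) :=
      iota_reflO hp2 hb
    rw [h1, qchar_eq_eps hb, eps_inj] at hι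
    exact hι

/-- `R_b ∈ K` iff `b` has the class `σ` (anisotropic `b`). -/
theorem refl_mem_iff (hp2 : p ≠ 2) {b : V p} (hb : b ⬝ᵥ b ≠ 0) :
    refl b ∈ classGroup p σ ↔ decide (IsSquare (b ⬝ᵥ b)) = σ :=
  ⟨class_of_refl_mem hp2 hb, refl_mem_classGroup hb⟩

/-! ## Both classes occur in `x^⊥` -/

variable {x ω : V p}

/-- **The non-degenerate plane `x^⊥` contains anisotropic vectors of every class.** -/
theorem exists_class (hp2 : p ≠ 2) (hq : x ⬝ᵥ x ≠ 0) (hQ : w₁ x ω ⬝ᵥ w₁ x ω ≠ 0) (τ : Bool) :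
    ∃ a : V p, a ⬝ᵥ x = 0 ∧ a ⬝ᵥ a ≠ 0 ∧ decide (IsSquare (a ⬝ᵥ a)) = τ := by
  have hQ₂ : w₂ x ω ⬝ᵥ w₂ x ω ≠ 0 := by rw [w₂_dot_self]; exact mul_ne_zero hq hQ
  by_cases hsq : IsSquare (x ⬝ᵥ x)
  · -- `q = r²`: `Q(u w₁ + (v/r) w₂) = Q₁ (u² + v²)` takes every value
    obtain ⟨r, hr⟩ := hsq
    have hr0 : r ≠ 0 := by rintro rfl; exact hq (by rw [hr, mul_zero])
    obtain ⟨t, ht0, ht⟩ : ∃ t : ZMod p, t ≠ 0 ∧ decide (IsSquare t) = τ := by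
      cases τ
      · obtain ⟨t, ht⟩ := FiniteField.exists_nonsquare
          (show ringChar (ZMod p) ≠ 2 by rw [ZMod.ringChar_zmod_n]; exact hp2)
        exact ⟨t, fun h => ht (h ▸ IsSquare.zero), decide_eq_false ht⟩
      · exact ⟨1, one_ne_zero, decide_eq_true IsSquare.one⟩
    obtain ⟨a, b, hab⟩ := ZMod.sq_add_sq p (t / (w₁ x ω ⬝ᵥ w₁ x ω))
    refine ⟨frame x ω (a, b / r), ReflectionClassPlane.frame_dot_x _, ?_⟩
    have hab' : (a ^ 2 + b ^ 2) * (w₁ x ω ⬝ᵥ w₁ x ω) = t := (eq_div_iff hQ).mp hab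
    have hval : frame x ω (a, b / r) ⬝ᵥ frame x ω (a, b / r) = t := by
      rw [frame_dot_frame, hr, show r * r * (b / r * (b / r)) = b * b by field_simp]
      linear_combination hab'
    rw [hval]
    exact ⟨ht0, ht⟩
  · -- `q` a nonsquare: `w₁` and `w₂` have different classes
    have hcls : IsSquare (w₂ x ω ⬝ᵥ w₂ x ω) ↔ ¬ IsSquare (w₁ x ω ⬝ᵥ w₁ x ω) := by
      rw [← quadraticChar_one_iff_isSquare hQ₂, ← quadraticChar_neg_one_iff_not_isSquare,
        w₂_dot_self, map_mul, quadraticChar_neg_one_iff_not_isSquare.mpr hsq]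
      rcases quadraticChar_dichotomy hQ with h | h <;> rw [h] <;> decide
    by_cases h1 : decide (IsSquare (w₁ x ω ⬝ᵥ w₁ x ω)) = τ
    · exact ⟨w₁ x ω, w₁_dot_x x ω, hQ, h1⟩
    · refine ⟨w₂ x ω, w₂_dot_x x ω, hQ₂, ?_⟩
      cases τ
      · simp only [decide_eq_false_iff_not, hcls, not_not]
        exact of_decide_eq_true (by simpa using h1)
      · simp only [decide_eq_true_eq, hcls]
        exact fun h => h1 (decide_eq_true h)

/-! ## Same-class products -/

/-- `ι` of a product of three reflections, in `ℤ`. -/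
theorem iota_refl₃ (z z₀ a : V p) (hO : refl z * refl z₀ * refl a ∈ O3 p) :
    ((iota ⟨refl z * refl z₀ * refl a, hO⟩ : ℤˣ) : ℤ) =
      (iota (reflO z) : ℤ) * (iota (reflO z₀) : ℤ) * (iota (reflO a) : ℤ) := by
  have h : (⟨refl z * refl z₀ * refl a, hO⟩ : O3 p) = reflO z * reflO z₀ * reflO a := rfl
  rw [h, map_mul, map_mul, Units.val_mul, Units.val_mul]

/-- **Same-class products lie in `K`.**  For anisotropic `z, z₀ ∈ x^⊥` of the same class,
`R_z R_{z₀} ∈ classGroup p σ` — for EITHER `σ`. -/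
theorem refl_mul_refl_mem (hp2 : p ≠ 2) (hq : x ⬝ᵥ x ≠ 0) (hQ : w₁ x ω ⬝ᵥ w₁ x ω ≠ 0)
    {z z₀ : V p} (hzx : z ⬝ᵥ x = 0) (hz : z ⬝ᵥ z ≠ 0) (hz₀x : z₀ ⬝ᵥ x = 0) (hz₀ : z₀ ⬝ᵥ z₀ ≠ 0)
    (hcl : IsSquare (z ⬝ᵥ z) ↔ IsSquare (z₀ ⬝ᵥ z₀)) :
    refl z * refl z₀ ∈ classGroup p σ := by
  by_cases hσ : decide (IsSquare (z ⬝ᵥ z)) = σ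
  · refine mul_mem (refl_mem_classGroup hz hσ) (refl_mem_classGroup hz₀ ?_)
    rw [← hσ]
    by_cases h : IsSquare (z ⬝ᵥ z)
    · rw [decide_eq_true h, decide_eq_true (hcl.mp h)]
    · rw [decide_eq_false h, decide_eq_false (fun h' => h (hcl.mpr h'))]
  · -- choose `a ∈ x^⊥` of class `σ`; `R_z R_{z₀} R_a` is an improper isometry fixing `x`
    obtain ⟨a, hax, ha, haσ⟩ := exists_class hp2 hq hQ σ
    have hO : refl z * refl z₀ * refl a ∈ O3 p :=
      mul_mem (mul_mem (refl_mem_O3 z) (refl_mem_O3 z₀)) (refl_mem_O3 a)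
    have hmat : ((refl z * refl z₀ * refl a : GLm p 3) : Mat p 3) =
        reflMat z * reflMat z₀ * reflMat a := by simp [Units.val_mul, coe_refl]
    have hgx : (reflMat z * reflMat z₀ * reflMat a) *ᵥ x = x := by
      rw [← Matrix.mulVec_mulVec, ← Matrix.mulVec_mulVec, reflMat_mulVec a x hax,
        reflMat_mulVec z₀ x hz₀x, reflMat_mulVec z x hzx]
    have hdet : (reflMat z * reflMat z₀ * reflMat a).det = -1 := by
      rw [Matrix.det_mul, Matrix.det_mul, det_reflMat z hz, det_reflMat z₀ hz₀, det_reflMat a ha]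
      ring
    obtain ⟨b, hbx, hb, hgb⟩ :=
      stab_improper hp2 hq hQ (hmat ▸ mem_O3.mp hO) hgx hdet
    -- the class of `b` is `σ`, by `ι`
    have hι := iota_refl₃ z z₀ a hO
    have hgO : (⟨refl z * refl z₀ * refl a, hO⟩ : O3 p) = reflO b :=
      Subtype.ext (Units.ext (by rw [hmat, hgb]; rfl))
    rw [hgO, iota_reflO hp2 hb, iota_reflO hp2 hz, iota_reflO hp2 hz₀, iota_reflO hp2 ha,
      (qchar_eq_iff hz hz₀).mpr hcl, ← sq, quadraticChar_sq_one hz₀, one_mul,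
      qchar_eq_eps hb, qchar_eq_eps ha, haσ, eps_inj] at hι
    -- `R_z R_{z₀} = R_b R_a`
    have heq : refl z * refl z₀ = refl b * refl a := by
      have h3 : refl z * refl z₀ * refl a * refl a = refl b * refl a :=
        congrArg (· * refl a) (Units.ext (by rw [hmat, hgb]; rfl) :
          refl z * refl z₀ * refl a = refl b)
      rwa [mul_assoc, show (refl a * refl a : GLm p 3) = 1 from
        Units.ext (by simp [reflMat_mul_self]), mul_one] at h3
    rw [heq]
    exact mul_mem (refl_mem_classGroup hb hι) (refl_mem_classGroup ha haσ)

/-! ## The stabiliser -/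

/-- Members of `K` are isometries. -/
theorem transpose_mul_self_of_mem (hp2 : p ≠ 2) {s : GLm p 3} (hs : s ∈ classGroup p σ) :
    ((s : Mat p 3))ᵀ * (s : Mat p 3) = 1 :=
  mem_O3.mp (iota_of_mem_classGroup hp2 σ hs).1

/-- **Improper stabiliser.**  `s ∈ K`, `s x = x`, `det s = −1` iff `s = R_z` with `z ∈ x^⊥`
anisotropic of class `σ`. -/
theorem stab_improper_iff (hp2 : p ≠ 2) (hq : x ⬝ᵥ x ≠ 0) (hQ : w₁ x ω ⬝ᵥ w₁ x ω ≠ 0)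
    (s : GLm p 3) :
    (s ∈ classGroup p σ ∧ (s : Mat p 3) *ᵥ x = x ∧ (s : Mat p 3).det = -1) ↔
      ∃ z : V p, z ⬝ᵥ x = 0 ∧ z ⬝ᵥ z ≠ 0 ∧ decide (IsSquare (z ⬝ᵥ z)) = σ ∧ s = refl z := by
  constructor
  · rintro ⟨hs, hsx, hdet⟩
    obtain ⟨z, hzx, hz, hsz⟩ :=
      stab_improper hp2 hq hQ (transpose_mul_self_of_mem hp2 hs) hsx hdet
    have hs' : s = refl z := Units.ext (by rw [hsz]; rfl)
    exact ⟨z, hzx, hz, class_of_refl_mem hp2 hz (hs' ▸ hs), hs'⟩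
  · rintro ⟨z, hzx, hz, hσz, rfl⟩
    exact ⟨refl_mem_classGroup hz hσz, reflMat_mulVec z x hzx, det_reflMat z hz⟩

/-- **Proper stabiliser.**  Fix an anisotropic `z₀ ∈ x^⊥` (of any class).  Then `s ∈ K`,
`s x = x`, `det s = 1` iff `s = R_z R_{z₀}` with `z ∈ x^⊥` anisotropic of the class of `z₀`. -/
theorem stab_proper_iff (hp2 : p ≠ 2) (hq : x ⬝ᵥ x ≠ 0) (hQ : w₁ x ω ⬝ᵥ w₁ x ω ≠ 0)
    {z₀ : V p} (hz₀x : z₀ ⬝ᵥ x = 0) (hz₀ : z₀ ⬝ᵥ z₀ ≠ 0) (s : GLm p 3) :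
    (s ∈ classGroup p σ ∧ (s : Mat p 3) *ᵥ x = x ∧ (s : Mat p 3).det = 1) ↔
      ∃ z : V p, z ⬝ᵥ x = 0 ∧ z ⬝ᵥ z ≠ 0 ∧ (IsSquare (z ⬝ᵥ z) ↔ IsSquare (z₀ ⬝ᵥ z₀)) ∧
        s = refl z * refl z₀ := by
  constructor
  · rintro ⟨hs, hsx, hdet⟩
    obtain ⟨hO, ⟨-, hι⟩ | ⟨hd, -⟩⟩ := iota_of_mem_classGroup hp2 σ hs
    swap
    · exact absurd (hd ▸ hdet) (neg_one_ne_one hp2)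
    -- `t = s R_{z₀}` is an improper isometry fixing `x`
    have hO' : s * refl z₀ ∈ O3 p := mul_mem hO (refl_mem_O3 z₀)
    have hmat : ((s * refl z₀ : GLm p 3) : Mat p 3) = (s : Mat p 3) * reflMat z₀ := by
      simp [Units.val_mul, coe_refl]
    have htx : ((s : Mat p 3) * reflMat z₀) *ᵥ x = x := by
      rw [← Matrix.mulVec_mulVec, reflMat_mulVec z₀ x hz₀x, hsx]
    have htdet : ((s : Mat p 3) * reflMat z₀).det = -1 := by
      rw [Matrix.det_mul, hdet, det_reflMat z₀ hz₀, one_mul]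
    obtain ⟨z, hzx, hz, htz⟩ := stab_improper hp2 hq hQ (hmat ▸ mem_O3.mp hO') htx htdet
    have hs' : s = refl z * refl z₀ := by
      have h3 : s * refl z₀ * refl z₀ = refl z * refl z₀ :=
        congrArg (· * refl z₀) (Units.ext (by rw [hmat, htz]; rfl) : s * refl z₀ = refl z)
      rwa [mul_assoc, show (refl z₀ * refl z₀ : GLm p 3) = 1 from
        Units.ext (by simp [reflMat_mul_self]), mul_one] at h3
    refine ⟨z, hzx, hz, ?_, hs'⟩
    -- same class: `ι(s) = 1 = χ(Q z) χ(Q z₀)`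
    have hsO : (⟨s, hO⟩ : O3 p) = reflO z * reflO z₀ := Subtype.ext hs'
    have h1 : ((iota ⟨s, hO⟩ : ℤˣ) : ℤ) = 1 := by rw [hι, Units.val_one]
    rw [hsO, map_mul, Units.val_mul, iota_reflO hp2 hz, iota_reflO hp2 hz₀] at h1
    have h2 : quadraticChar (ZMod p) (z ⬝ᵥ z) = quadraticChar (ZMod p) (z₀ ⬝ᵥ z₀) := by
      have h3 := congrArg (· * quadraticChar (ZMod p) (z₀ ⬝ᵥ z₀)) h1
      rwa [mul_assoc, ← sq, quadraticChar_sq_one hz₀, mul_one, one_mul] at h3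
    exact (qchar_eq_iff hz hz₀).mp h2
  · rintro ⟨z, hzx, hz, hcl, rfl⟩
    refine ⟨refl_mul_refl_mem hp2 hq hQ hzx hz hz₀x hz₀ hcl, ?_, ?_⟩
    · rw [Units.val_mul, coe_refl, coe_refl, ← Matrix.mulVec_mulVec, reflMat_mulVec z₀ x hz₀x,
        reflMat_mulVec z x hzx]
    · rw [Units.val_mul, coe_refl, coe_refl, Matrix.det_mul, det_reflMat z hz,
        det_reflMat z₀ hz₀]; ring

/-! ## Fibres of the parametrisation -/

/-- `R_z = R_{z'}` iff `z' = s z`, `s ≠ 0` (anisotropic `z`). -/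
theorem refl_eq_refl_iff (hp2 : p ≠ 2) {z z' : V p} (hz : z ⬝ᵥ z ≠ 0) :
    refl z = refl z' ↔ ∃ s : ZMod p, s ≠ 0 ∧ z' = s • z := by
  constructor
  · intro h
    exact eq_smul_of_reflMat_eq hp2 hz (by rw [← coe_refl, ← coe_refl, h])
  · rintro ⟨s, hs, rfl⟩
    exact Units.ext (Matrix.ext_iff_mulVec.mpr fun v => (refl_smul hs z v).symm)

/-- A reflection is never a product `R_z R_{z₀}` of two genuine reflections (determinant). -/
theorem refl_ne_refl_mul (hp2 : p ≠ 2) {z z' z₀ : V p} (hz : z ⬝ᵥ z ≠ 0) (hz' : z' ⬝ᵥ z' ≠ 0)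
    (hz₀ : z₀ ⬝ᵥ z₀ ≠ 0) : refl z ≠ refl z' * refl z₀ := by
  intro h
  have hd := congrArg (fun g : GLm p 3 => (g : Mat p 3).det) h
  simp only [Units.val_mul, coe_refl, Matrix.det_mul, det_reflMat z hz, det_reflMat z' hz',
    det_reflMat z₀ hz₀, mul_neg, mul_one, neg_neg] at hd
  exact neg_one_ne_one hp2 hd

end K

end ReflectionClassStabClass
end Summit.MatrixMultiplication.MatrixMultiplication.Theorems.SubgroupIdentityDesigns.Negative
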